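import Literature.Probability.RandomPlanarGeometry.RectilinearPolygonGrid
import Literature.Probability.RandomPlanarGeometry.PlanarDomainsTopology
import Literature.Topology.PlaneTopology.JordanCurveProofs
import Mathlib.Analysis.Complex.ReImTopology

/-!
# Tubes along the edges of a rectilinear simple polygon
(route CardyQContinuation, serves stmt-CriticalPhenomena-5560: helper for the registered stub
`stub_design_meshQuad` of the n = 0 bridge of the crux `IsingJetsConformal`)

Let `l` be a rectilinear simple closed polygon whose vertex abscissae (resp. ordinates) are equal
or at least `g` apart, and whose inside `P` lies locally to the left of every edge. We rotate each
edge `v → w` to the positive real direction (`edgeRot`, one of `±1, ±i`, as a real-linear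
automorphism `rotCLE`) and prove the two **tube lemmas**: the closed band of width `g/2` on the
left of the edge lies in `closure P` (`closedBand_subset_closure`), and a point of the open band
of width `g` on the right of the open edge, off the vertical lines through the vertices, lies
outside `closure P` (`not_mem_closure_of_mem_lowerBand`). The proofs combine monochromatic
vertex-free boxes with the fact that every point of the Jordan curve `∂P` is a limit of exterior
points. [folklore]
-/

noncomputable section

namespace Summit.CriticalPhenomena.CardyFormulaZ2.Theorems.CardyQContinuation

namespace Tube

open Set Complex Filter Topology Literature.Probability.RandomPlanarGeometry

/-! ### Rotations by `±1, ±i` -/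

/-- Multiplication by a nonzero complex number as a real-linear automorphism of `ℂ`.
[folklore] -/
def rotCLE (c : ℂ) (hc : c ≠ 0) : ℂ ≃L[ℝ] ℂ :=
  (DistribMulAction.toLinearEquiv ℝ ℂ (Units.mk0 c hc)).toContinuousLinearEquiv

/-- `rotCLE c` is multiplication by `c`. [folklore] -/
@[simp] theorem rotCLE_apply (c : ℂ) (hc : c ≠ 0) (z : ℂ) : rotCLE c hc z = c * z := rfl

/-- The unit `c ∈ {1, -1, -i, i}` turning the axis-parallel vector `Δ` to the positive reals.
[folklore] -/
def edgeRot (Δ : ℂ) : ℂ :=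
  if Δ.im = 0 then (if 0 < Δ.re then 1 else -1) else (if 0 < Δ.im then -I else I)

/-- `edgeRot Δ ≠ 0`. [folklore] -/
theorem edgeRot_ne_zero (Δ : ℂ) : edgeRot Δ ≠ 0 := by
  unfold edgeRot; split_ifs <;> simp [Complex.ext_iff]

/-- `edgeRot Δ` is one of `1, -1, -i, i`. [folklore] -/
theorem edgeRot_cases (Δ : ℂ) : edgeRot Δ = 1 ∨ edgeRot Δ = -1 ∨ edgeRot Δ = -I ∨ edgeRot Δ = I := by
  unfold edgeRot; split_ifs <;> simp

/-- Rotating an axis-parallel nonzero vector to the positive reals. [folklore] -/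
theorem edgeRot_mul {Δ : ℂ} (hΔ : Δ ≠ 0) (hax : Δ.re = 0 ∨ Δ.im = 0) :
    edgeRot Δ * Δ = (‖Δ‖ : ℂ) ∧ 0 < ‖Δ‖ := by
  refine ⟨?_, norm_pos_iff.2 hΔ⟩
  have key : ∀ x : ℝ, ‖(x : ℂ)‖ = |x| := fun x ↦ by simp
  unfold edgeRot
  rcases hax with hre | him
  · have him : Δ.im ≠ 0 := fun him ↦ hΔ (Complex.ext (by simp [hre]) (by simp [him]))
    have hΔ' : Δ = Δ.im * I := Complex.ext (by simp [hre]) (by simp)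
    rw [if_neg him]
    split_ifs with hpos
    · conv_lhs => rw [hΔ']
      conv_rhs => rw [hΔ']
      rw [norm_mul, Complex.norm_I, mul_one, key, abs_of_pos hpos]
      ring_nf; simp [I_sq]
    · have hneg : Δ.im < 0 := lt_of_le_of_ne (not_lt.1 hpos) him
      conv_lhs => rw [hΔ']
      conv_rhs => rw [hΔ']
      rw [norm_mul, Complex.norm_I, mul_one, key, abs_of_neg hneg]
      push_cast; ring_nf; simp [I_sq]
  · rw [if_pos him]
    have hre : Δ.re ≠ 0 := fun hre ↦ hΔ (Complex.ext (by simp [hre]) (by simp [him]))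
    have hΔ' : Δ = (Δ.re : ℂ) := Complex.ext (by simp) (by simp [him])
    split_ifs with hpos
    · conv_lhs => rw [hΔ']
      conv_rhs => rw [hΔ']
      rw [key, abs_of_pos hpos]; ring
    · have hneg : Δ.re < 0 := lt_of_le_of_ne (not_lt.1 hpos) hre
      conv_lhs => rw [hΔ']
      conv_rhs => rw [hΔ']
      rw [key, abs_of_neg hneg]; push_cast; ring

/-- Axis-parallel pairs stay axis-parallel under the four rotations. [folklore] -/
theorem rect_of_rect {c : ℂ} (hc : c = 1 ∨ c = -1 ∨ c = -I ∨ c = I) {a b : ℂ}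
    (hab : a.re = b.re ∨ a.im = b.im) : (c * a).re = (c * b).re ∨ (c * a).im = (c * b).im := by
  rcases hc with rfl | rfl | rfl | rfl <;> rcases hab with h | h <;> simp [h]

/-! ### The setting -/

section Edges

variable {l : List ℂ} (h : IsSimpleClosedPolygon l) {g : ℝ}
  (hrect : ∀ (k : ℕ) (hk : k < l.length),
    (l[k]).re = (l[(k + 1) % l.length]'(Nat.mod_lt _ h.pos)).re ∨
    (l[k]).im = (l[(k + 1) % l.length]'(Nat.mod_lt _ h.pos)).im)
  (hgre : ∀ (i j : ℕ) (hi : i < l.length) (hj : j < l.length),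
    |(l[i]).re - (l[j]).re| < g → (l[i]).re = (l[j]).re)
  (hgim : ∀ (i j : ℕ) (hi : i < l.length) (hj : j < l.length),
    |(l[i]).im - (l[j]).im| < g → (l[i]).im = (l[j]).im)
  (hin : ∀ (k : ℕ) (hk : k < l.length) (θ : ℝ), θ ∈ Ioo (0 : ℝ) 1 →
    ∀ᶠ s : ℝ in 𝓝[>] (0 : ℝ), polygonLoop l ((k + θ) / l.length) +
      (s : ℂ) * (I * (l[(k + 1) % l.length]'(Nat.mod_lt _ h.pos) - l[k])) ∈ (polygonDomain l h).carrier)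

/-- The rotation of the edge `k`. [folklore] -/
def σ (k : ℕ) (hk : k < l.length) : ℂ ≃L[ℝ] ℂ :=
  rotCLE (edgeRot (l[(k + 1) % l.length]'(Nat.mod_lt _ h.pos) - l[k])) (edgeRot_ne_zero _)

/-- The rotation of the edge `k` is multiplication by `edgeRot` of its vector. [folklore] -/
theorem σ_apply (k : ℕ) (hk : k < l.length) (z : ℂ) :
    σ h k hk z = edgeRot (l[(k + 1) % l.length]'(Nat.mod_lt _ h.pos) - l[k]) * z := rfl

include hrect in
/-- **The rotated edge**: after the rotation the edge vector is the positive real `‖w - v‖`, so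
the edge is horizontal, going right. [folklore] -/
theorem σ_edge (k : ℕ) (hk : k < l.length) :
    σ h k hk (l[(k + 1) % l.length]'(Nat.mod_lt _ h.pos)) - σ h k hk l[k] =
        (‖l[(k + 1) % l.length]'(Nat.mod_lt _ h.pos) - l[k]‖ : ℂ) ∧
      0 < ‖l[(k + 1) % l.length]'(Nat.mod_lt _ h.pos) - l[k]‖ := by
  have hne : l[(k + 1) % l.length]'(Nat.mod_lt _ h.pos) - l[k] ≠ 0 :=
    sub_ne_zero.2 (h.ne k hk).symm
  have hax : (l[(k + 1) % l.length]'(Nat.mod_lt _ h.pos) - l[k]).re = 0 ∨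
      (l[(k + 1) % l.length]'(Nat.mod_lt _ h.pos) - l[k]).im = 0 := by
    rcases hrect k hk with h1 | h1
    · left; simp [h1]
    · right; simp [h1]
  obtain ⟨hmul, hpos⟩ := edgeRot_mul hne hax
  refine ⟨?_, hpos⟩
  rw [σ_apply, σ_apply, ← mul_sub, hmul]

include hrect in
/-- The rotated edge is horizontal: same ordinate at both ends, abscissa increased by the length.
[folklore] -/
theorem σ_edge_re_im (k : ℕ) (hk : k < l.length) :
    (σ h k hk (l[(k + 1) % l.length]'(Nat.mod_lt _ h.pos))).re =
        (σ h k hk l[k]).re + ‖l[(k + 1) % l.length]'(Nat.mod_lt _ h.pos) - l[k]‖ ∧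
      (σ h k hk (l[(k + 1) % l.length]'(Nat.mod_lt _ h.pos))).im = (σ h k hk l[k]).im := by
  obtain ⟨he, -⟩ := σ_edge h hrect k hk
  have hre := congrArg Complex.re he
  have him := congrArg Complex.im he
  simp only [sub_re, sub_im, ofReal_re, ofReal_im] at hre him
  exact ⟨by linarith, by linarith⟩

include hrect in
/-- The rectilinearity hypothesis in rotated coordinates. [folklore] -/
theorem hrect_σ (k : ℕ) (hk : k < l.length) :
    ∀ (j : ℕ) (hj : j < l.length),
      (σ h k hk l[j]).re = (σ h k hk (l[(j + 1) % l.length]'(Nat.mod_lt _ h.pos))).re ∨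
      (σ h k hk l[j]).im = (σ h k hk (l[(j + 1) % l.length]'(Nat.mod_lt _ h.pos))).im := fun j hj ↦ by
  rw [σ_apply, σ_apply]
  exact rect_of_rect (edgeRot_cases _) (hrect j hj)

include hgre hgim in
/-- **Grid gaps in rotated coordinates**: two vertex abscissae (resp. ordinates) after rotation are
equal or at least `g` apart. [folklore] -/
theorem gap_σ (k : ℕ) (hk : k < l.length) :
    (∀ (i j : ℕ) (hi : i < l.length) (hj : j < l.length),
      |(σ h k hk l[i]).re - (σ h k hk l[j]).re| < g → (σ h k hk l[i]).re = (σ h k hk l[j]).re) ∧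
    (∀ (i j : ℕ) (hi : i < l.length) (hj : j < l.length),
      |(σ h k hk l[i]).im - (σ h k hk l[j]).im| < g → (σ h k hk l[i]).im = (σ h k hk l[j]).im) := by
  simp only [σ_apply]
  have negabs : ∀ a b : ℝ, |-a - -b| = |a - b| := fun a b ↦ by rw [neg_sub_neg, abs_sub_comm]
  rcases edgeRot_cases (l[(k + 1) % l.length]'(Nat.mod_lt _ h.pos) - l[k]) with hc | hc | hc | hc <;>
    rw [hc]
  · simpa using And.intro hgre hgim
  · simp only [neg_mul, one_mul, neg_re, neg_im, negabs, neg_inj]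
    exact ⟨hgre, hgim⟩
  · simp only [neg_mul, neg_re, neg_im, Complex.I_mul_re, Complex.I_mul_im, neg_neg, negabs, neg_inj]
    exact ⟨fun i j hi hj hlt ↦ hgim i j hi hj hlt, fun i j hi hj hlt ↦ hgre i j hi hj hlt⟩
  · simp only [Complex.I_mul_re, Complex.I_mul_im, negabs, neg_inj]
    exact ⟨fun i j hi hj hlt ↦ hgim i j hi hj hlt, fun i j hi hj hlt ↦ hgre i j hi hj hlt⟩

/-! ### Monochromatic boxes above and below the edge -/

include hrect hgim hgre in
/-- **An open box above or below the edge, between two consecutive vertex abscissae, is vertex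
free**, hence inside `P` or off `closure P`. Here `p < q` are such that no rotated vertex abscissa
lies in `(p, q)`, and the box has rotated ordinates in `(β, β + g)` or `(β - g, β)` where `β` is
the rotated ordinate of the edge. [folklore] -/
theorem box_mono (k : ℕ) (hk : k < l.length) {p q : ℝ}
    (hpq : ∀ (i : ℕ) (hi : i < l.length), (σ h k hk l[i]).re ∉ Ioo p q) {c d : ℝ}
    (hcd : (c = (σ h k hk l[k]).im ∧ d = c + g) ∨ (d = (σ h k hk l[k]).im ∧ c = d - g)) :
    σ h k hk ⁻¹' (Ioo p q ×ℂ Ioo c d) ⊆ (polygonDomain l h).carrier ∨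
      σ h k hk ⁻¹' (Ioo p q ×ℂ Ioo c d) ⊆ (closure (polygonDomain l h).carrier)ᶜ := by
  refine h.box_subset_or_subset (σ h k hk) (hrect_σ h hrect k hk) hpq fun i hi hmem ↦ ?_
  obtain ⟨-, hgi⟩ := gap_σ h hgre hgim k hk
  have := hgi i k hi hk
  rcases hcd with ⟨rfl, rfl⟩ | ⟨rfl, rfl⟩
  · have e := this (by rw [abs_lt]; constructor <;> linarith [hmem.1, hmem.2])
    linarith [hmem.1]
  · have e := this (by rw [abs_lt]; constructor <;> linarith [hmem.1, hmem.2])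
    linarith [hmem.2]

include hrect hin in
/-- **Points just above the open edge are inside**: above each point strictly inside the rotated
edge there are points of `P` arbitrarily close, in the rotated box `(p, q) × (β, β + g)`.
[folklore] -/
theorem exists_mem_above (hg : 0 < g) (k : ℕ) (hk : k < l.length) {p q : ℝ} {x : ℝ} (hx : x ∈ Ioo p q)
    (hx1 : (σ h k hk l[k]).re < x) (hx2 : x < (σ h k hk (l[(k + 1) % l.length]'(Nat.mod_lt _ h.pos))).re) :
    ∃ z ∈ (polygonDomain l h).carrier,
      z ∈ σ h k hk ⁻¹' (Ioo p q ×ℂ Ioo (σ h k hk l[k]).im ((σ h k hk l[k]).im + g)) := by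
  set v := l[k] with hv
  set w := l[(k + 1) % l.length]'(Nat.mod_lt _ h.pos) with hw
  obtain ⟨he, hpos⟩ := σ_edge h hrect k hk
  obtain ⟨hre, him⟩ := σ_edge_re_im h hrect k hk
  set ℓ := ‖w - v‖ with hℓ
  -- the point of the edge with abscissa `x`
  set θ := (x - (σ h k hk v).re) / ℓ with hθ
  have hθ0 : 0 < θ := div_pos (by linarith) hpos
  have hθ1 : θ < 1 := by rw [hθ, div_lt_one hpos]; linarith
  have hθx : (σ h k hk v).re + θ * ℓ = x := by rw [hθ, div_mul_cancel₀ _ hpos.ne']; ring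
  -- a small positive `s` with the interior point above the edge and `s ℓ < g`
  have hev := hin k hk θ ⟨hθ0, hθ1⟩
  have hsmall : ∀ᶠ s : ℝ in 𝓝[>] (0 : ℝ), 0 < s ∧ s * ℓ < g := by
    have h1 : ∀ᶠ s : ℝ in 𝓝[>] (0 : ℝ), 0 < s := eventually_mem_nhdsWithin
    have h2 : ∀ᶠ s : ℝ in 𝓝[>] (0 : ℝ), s * ℓ < g := by
      have : Tendsto (fun s : ℝ ↦ s * ℓ) (𝓝[>] (0 : ℝ)) (𝓝 0) := by
        have := ((continuous_mul_const ℓ).tendsto (0 : ℝ)).mono_left (nhdsWithin_le_nhds (s := Ioi (0 : ℝ)))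
        rwa [zero_mul] at this
      exact this.eventually (gt_mem_nhds hg)
    exact h1.and h2
  obtain ⟨s, hsP, hs0, hsℓ⟩ := (hev.and hsmall).exists
  refine ⟨_, hsP, ?_⟩
  -- rotated coordinates of the point
  have hc : σ h k hk (w - v) = (ℓ : ℂ) := by rw [map_sub, he]
  have hpt : σ h k hk (polygonLoop l ((k + θ) / l.length) + (s : ℂ) * (I * (w - v))) =
      σ h k hk v + (θ * ℓ : ℝ) + (s * ℓ : ℝ) * I := by
    rw [polygonLoop_apply_div hk ⟨hθ0.le, hθ1.le⟩]
    show σ h k hk (AffineMap.lineMap v w θ + (s : ℂ) * (I * (w - v))) = _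
    rw [AffineMap.lineMap_apply_module', map_add, map_add]
    have e2 : σ h k hk (θ • (w - v)) = ((θ * ℓ : ℝ) : ℂ) := by
      rw [map_smul, hc, Complex.real_smul]; push_cast; ring
    have e3 : σ h k hk ((s : ℂ) * (I * (w - v))) = ((s * ℓ : ℝ) : ℂ) * I := by
      rw [σ_apply, show edgeRot (w - v) * ((s : ℂ) * (I * (w - v))) = (s : ℂ) * I * (edgeRot (w - v) * (w - v)) by ring,
        ← σ_apply h k hk, hc]
      push_cast; ring
    rw [e2, e3]; ring
  rw [mem_preimage, hpt, mem_reProdIm]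
  constructor
  · simp only [add_re, ofReal_re, mul_re, I_re, I_im, mul_zero, ofReal_im, mul_one, add_zero, sub_self]
    rw [hθx]; exact hx
  · simp only [add_im, ofReal_im, mul_im, I_re, I_im, mul_zero, ofReal_re, mul_one, add_zero]
    exact ⟨by nlinarith, by linarith⟩

/-! ### Consecutive vertex abscissae -/

/-- The rotated vertex abscissae. [folklore] -/
def absc (k : ℕ) (hk : k < l.length) : Finset ℝ := (l.map fun z ↦ (σ h k hk z).re).toFinset

/-- Vertex abscissae are in `absc`. [folklore] -/
theorem mem_absc (k : ℕ) (hk : k < l.length) {i : ℕ} (hi : i < l.length) : (σ h k hk l[i]).re ∈ absc h k hk := by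
  simp only [absc, List.mem_toFinset, List.mem_map]
  exact ⟨l[i], List.getElem_mem hi, rfl⟩

/-- Around an abscissa strictly between two vertex abscissae and different from all of them there
is a vertex-free open interval. [folklore] -/
theorem exists_free_Ioo (k : ℕ) (hk : k < l.length) {x a b : ℝ} (ha : a ∈ absc h k hk) (hb : b ∈ absc h k hk)
    (hax : a < x) (hxb : x < b) (hx : x ∉ absc h k hk) :
    ∃ p q : ℝ, a ≤ p ∧ p < x ∧ x < q ∧ q ≤ b ∧ ∀ (i : ℕ) (hi : i < l.length), (σ h k hk l[i]).re ∉ Ioo p q := by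
  classical
  set Lo := (absc h k hk).filter (· < x) with hLo
  set Hi := (absc h k hk).filter (x < ·) with hHi
  have hLo_ne : Lo.Nonempty := ⟨a, by simp [hLo, ha, hax]⟩
  have hHi_ne : Hi.Nonempty := ⟨b, by simp [hHi, hb, hxb]⟩
  refine ⟨Lo.max' hLo_ne, Hi.min' hHi_ne, Finset.le_max' _ _ (by simp [hLo, ha, hax]),
    ?_, ?_, Finset.min'_le _ _ (by simp [hHi, hb, hxb]), fun i hi hmem ↦ ?_⟩
  · have := Finset.max'_mem Lo hLo_ne; exact (Finset.mem_filter.1 this).2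
  · have := Finset.min'_mem Hi hHi_ne; exact (Finset.mem_filter.1 this).2
  · have hyi := mem_absc h k hk hi
    rcases lt_trichotomy ((σ h k hk l[i]).re) x with hlt | heq | hgt
    · have : (σ h k hk l[i]).re ≤ Lo.max' hLo_ne := Finset.le_max' _ _ (by simp [hLo, hyi, hlt])
      linarith [hmem.1]
    · exact hx (heq ▸ hyi)
    · have : Hi.min' hHi_ne ≤ (σ h k hk l[i]).re := Finset.min'_le _ _ (by simp [hHi, hyi, hgt])
      linarith [hmem.2]

end Edges

end Tube

end Summit.CriticalPhenomena.CardyFormulaZ2.Theorems.CardyQContinuation
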